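/-
Origin: expansion seat `planner-pub-hodgecm-pv10-0`, handover 2026-08-18T03:54:32Z (`HOME/pub-hodgecm-pv10/lean/Pv10/HeckeCharExtension.lean`, md5 2389b811, 77 lines);
landed by the gen-5 packager in gate run 20 as `HodgeCM/PerL34/HeckeCharExtension.lean` (import ^import Pv[0-9]+\.→import HodgeCM.PerL34. ×2).
-/
/-
Origin: planner-pub-hodgecm-pv10-0 (unit pub-hodgecm-pv10), HodgeCM publication cell, 2026-08-18.
Node N15 (PerL v5 §3.2, tex ll. 304–314) over Mathlib's REAL ideles: the instance of
`CharExtensionN15.lean` §4 (E4) with the openness input supplied by `IdeleClassGroup.lean`.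
At landing the two `Pv10.*` imports become `HodgeCM.PerL34.IdeleClassGroup` / `HodgeCM.PerL34.CharExtensionN15`.
-/
import Summits.HodgeConjecture.HodgeCM.PerL34.IdeleClassGroup
import Summits.HodgeConjecture.HodgeCM.PerL34.CharExtensionN15

/-!
# N15 over Mathlib's ideles: extending a character from a subgroup of `C_K` to a unitary Hecke character

`K` a number field, `C_K = 𝔸_K^× / K^×` (`NumberField.IdeleClassGroup K`), `B ≤ C_K` ANY subgroup
containing the image of `K_∞^×`, `χ : B →* S¹` an abstract homomorphism.  If

* (∞-type) `x ↦ χ [x]` is continuous on `K_∞^×`, and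
* (conductor) `χ = 1` on `B ∩ [U]` for some open subgroup `U` of `(∏_v 𝒪_v)^×`,

then `χ` extends to a unitary Hecke character `ψ : C_K →ₜ* S¹` — `exists_unitaryHeckeCharacter_extension`.
This is the use of N15 at ll. 307–310 ("extend `χ_B` from the allowed subgroup to a Hecke character of
`L`"), with NO appeal to Pontryagin duality: the kernel-checked inputs are E1 (divisibility of `S¹`),
the open embedding `K_∞^× × (∏_v 𝒪_v)^× ↪ 𝔸_K^×`, and openness of `𝔸_K^× → C_K`.  What remains PerL's
(ll. 308–310) is to check the two bullet hypotheses for the specific `B` and `χ_B` of Lemma 3.3 — the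
arithmetic of the allowed subgroup, not topology (GAPS.md pv10-G2).
-/

set_option autoImplicit false

noncomputable section

open Topology Filter Set

namespace NumberField

open HodgeCM.PerL34.CharExtensionN15

variable (K : Type*) [Field K] [NumberField K]

/-- **N15 over real ideles (sharp form).**  A homomorphism `χ : B → S¹` on a subgroup `B ≤ C_K`
containing the classes of `K_∞^×`, continuous along `K_∞^×` and trivial on `B ∩ [U]` for an open subgroup
`U ≤ (∏_v 𝒪_v)^×`, extends to a unitary Hecke character of `K`. -/
theorem exists_unitaryHeckeCharacter_extension (B : Subgroup (IdeleClassGroup K))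
    (hNB : ∀ x : (InfiniteAdeleRing K)ˣ, infUnitsToClass K x ∈ B) (χ : B →* Circle)
    (hχinf : Continuous fun x : (InfiniteAdeleRing K)ˣ => χ ⟨infUnitsToClass K x, hNB x⟩)
    (U : OpenSubgroup (integralAdeles K)ˣ)
    (hU : ∀ b : B, (b : IdeleClassGroup K) ∈ (U : Subgroup (integralAdeles K)ˣ).map (intUnitsToClass K) →
      χ b = 1) :
    ∃ ψ : UnitaryHeckeCharacter K, ∀ b : B, ψ (b : IdeleClassGroup K) = χ b := by
  obtain ⟨χ', hcont, hext⟩ :=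
    exists_continuous_circleChar_extension_of_nhds_mul_of_trivialOn (G := IdeleClassGroup K)
      (N := (InfiniteAdeleRing K)ˣ) (K := (integralAdeles K)ˣ) B (infUnitsToClass K)
      (intUnitsToClass K) hNB (fun _ hs => image_infUnits_mul_intUnits_mem_nhds K hs) χ hχinf U hU
  exact ⟨{ χ' with continuous_toFun := hcont }, hext⟩

/-- In particular such a `χ` is continuous on `B` (subspace topology of `C_K`). -/
theorem continuous_of_continuous_inf_of_trivialOn (B : Subgroup (IdeleClassGroup K))
    (hNB : ∀ x : (InfiniteAdeleRing K)ˣ, infUnitsToClass K x ∈ B) (χ : B →* Circle)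
    (hχinf : Continuous fun x : (InfiniteAdeleRing K)ˣ => χ ⟨infUnitsToClass K x, hNB x⟩)
    (U : OpenSubgroup (integralAdeles K)ˣ)
    (hU : ∀ b : B, (b : IdeleClassGroup K) ∈ (U : Subgroup (integralAdeles K)ˣ).map (intUnitsToClass K) →
      χ b = 1) :
    Continuous χ := by
  obtain ⟨ψ, hψ⟩ := exists_unitaryHeckeCharacter_extension K B hNB χ hχinf U hU
  have h : (χ : B → Circle) = fun b : B => ψ (b : IdeleClassGroup K) := funext fun b => (hψ b).symm
  rw [h]
  exact ψ.continuous.comp continuous_subtype_val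

/-- **Uniqueness side** is automatic on `B`; off `B` the extension is of course not unique.  What IS
determined: two unitary Hecke characters agreeing on a subgroup `B` agree on its closure. -/
theorem UnitaryHeckeCharacter.eqOn_closure {ψ₁ ψ₂ : UnitaryHeckeCharacter K}
    (B : Subgroup (IdeleClassGroup K)) (h : ∀ b : B, ψ₁ (b : IdeleClassGroup K) = ψ₂ b) :
    Set.EqOn ψ₁ ψ₂ (closure (B : Set (IdeleClassGroup K))) :=
  Set.EqOn.closure (fun x hx => h ⟨x, hx⟩) ψ₁.continuous ψ₂.continuous

end NumberField

end
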